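import Mathlib.Analysis.SpecialFunctions.Complex.CircleAddChar
import Mathlib.Algebra.BigOperators.Intervals
import Literature.Barriers.AtomisticToContinuum.CohnElkiesNotSharp3DCertificate
import Literature.Barriers.AtomisticToContinuum.CohnElkiesNotSharp3DData
import HarnessLib

/-!
# The Cohn–Elkies bound is not sharp in `ℝ³` (Li 2022) — semantics of the kernel checker

Bridge between the kernel programs of `CohnElkiesNotSharp3DData.lean` and the `Finset` sums they
stand for, for the discharge of `Li2022_dualCertificate53` (`CohnElkiesNotSharp3DDischarge.lean`):

* §1 the folded `Nat.rec` loops over absolute values are sums over `ℤ₅₃` (`natSum_pmPow`,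
  `natSum_twice`), and sums over `ℤ₅₃³` are triple sums (`sum_vec3`);
* §2 the accumulators are packed sums `accᵢ = ∑_x ν(x) 2^{128 Eᵢ(x)}` with exponent maps
  `E₁(x) = x₀ + (a x₁ mod 53) + (b x₂ mod 53)` etc., and `total = ∑_x ν(x)`;
* §3 digit extraction from packed sums (`digit_packed`): the three digits `52, 105, 158` of
  `acc · cosPacked t` add up to `∑_x ν(x) C⁰(t (E(x) mod 53) mod 53)` (`dot3_packed`);
* §4 real parts: `Re ∑_x ν(x) ψ(⟨x,y⟩) = ∑_x ν(x) cos (2π⟨x,y⟩/53)` and, with the certified bounds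
  `C⁺ - C⁻ ≤ 2^48 cos` of `CohnElkiesNotSharp3DCosBounds.lean`, the kernel test `checkAcc acc = true`
  yields `Re ν̂(t u) ≥ 0` for `1 ≤ t ≤ 26` whenever `E ≡ ⟨·,u⟩ (mod 53)`, `E ≤ 156`
  (`re_nonneg_of_checkAcc`).

## Sources

R. Li, arXiv:2206.09876 (2022), §4 Problem 3 and eq. (1)–(2) (p. 8), §5 (p. 9). The packed
arithmetic and its semantics: this formalization. [folklore]
-/

noncomputable section

namespace Literature.Barriers.AtomisticToContinuum

open Finset Complex
open scoped Real BigOperators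

/-! ## §1 Loop semantics -/

/-- `natSum` is a `Finset.range` sum. [folklore] -/
theorem natSum_eq (n : ℕ) (f : ℕ → ℕ) : natSum n f = ∑ i ∈ range n, f i := by
  induction n with
  | zero => rfl
  | succ n ih => rw [sum_range_succ, ← ih]; rfl

/-- `absZ` of a small natural residue. [folklore] -/
theorem absZ_natCast {v : ℕ} (hv : v ≤ 26) : absZ (v : ZMod 53) = v := by
  unfold absZ
  rw [ZMod.valMinAbs_natCast_of_le_half (by norm_num; omega), Int.natAbs_natCast]

/-- `val` of the negative of a small non-zero natural residue. [folklore] -/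
theorem val_neg_natCast {v : ℕ} (h1 : 1 ≤ v) (h2 : v ≤ 52) : (-(v : ZMod 53)).val = 53 - v := by
  rw [ZMod.neg_val, ZMod.val_natCast_of_lt (by omega), if_neg]
  intro h
  rw [ZMod.natCast_eq_zero_iff] at h
  omega

/-- Folding a sum over `ℤ₅₃` onto absolute values: `∑_z F z = F 0 + ∑_{v=1}^{26} (F v + F (-v))`.
[folklore] -/
theorem sum_zmod_fold (F : ZMod 53 → ℕ) :
    ∑ z : ZMod 53, F z = F 0 + ∑ v ∈ Ico (1 : ℕ) 27, (F (v : ZMod 53) + F (-(v : ZMod 53))) := by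
  have h1 : ∑ z : ZMod 53, F z = ∑ v ∈ Ico (0 : ℕ) 53, F (v : ZMod 53) := by
    calc ∑ z : ZMod 53, F z = ∑ z : ZMod 53, F ((z.val : ℕ) : ZMod 53) := by
          simp_rw [ZMod.natCast_zmod_val]
      _ = ∑ v ∈ range 53, F (v : ZMod 53) := Fin.sum_univ_eq_sum_range (fun v => F (v : ZMod 53)) 53
      _ = _ := by rw [Finset.range_eq_Ico]
  have hA := Finset.sum_Ico_consecutive (fun w : ℕ => F (w : ZMod 53)) (Nat.zero_le 27)
    (show 27 ≤ 53 by norm_num)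
  have hB := Finset.sum_Ico_consecutive (fun w : ℕ => F (w : ZMod 53)) (Nat.zero_le 1)
    (show 1 ≤ 27 by norm_num)
  have hC : ∑ v ∈ Ico (0 : ℕ) 1, F (v : ZMod 53) = F 0 := by
    rw [← Finset.range_eq_Ico, sum_range_one, Nat.cast_zero]
  have hR := Finset.sum_Ico_reflect (fun w : ℕ => F (w : ZMod 53)) 1 (show 27 ≤ 53 + 1 by norm_num)
  simp only [show 53 + 1 - 27 = 27 by norm_num, show 53 + 1 - 1 = 53 by norm_num] at hR
  have hD : ∑ v ∈ Ico (1 : ℕ) 27, F ((53 - v : ℕ) : ZMod 53) = ∑ v ∈ Ico (1 : ℕ) 27, F (-(v : ZMod 53)) := by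
    refine sum_congr rfl fun v hv => ?_
    rw [mem_Ico] at hv
    rw [Nat.cast_sub (by omega), ZMod.natCast_self, zero_sub]
  have hE := Finset.sum_add_distrib (s := Ico (1 : ℕ) 27) (f := fun w : ℕ => F (w : ZMod 53))
    (g := fun v : ℕ => F (-(v : ZMod 53)))
  rw [h1, hE]
  omega

/-- The folded loop with packed weights is the sum over `ℤ₅₃`:
`natSum 27 (g v · pmPow e v) = ∑_z g |z| 2^{128 e(z.val)}`. [folklore] -/
theorem natSum_pmPow (g : ℕ → ℕ) (e : ℕ → ℕ) :
    natSum 27 (fun v => g v * pmPow e v) = ∑ z : ZMod 53, g (absZ z) * 2 ^ (128 * e z.val) := by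
  rw [sum_zmod_fold, natSum_eq, Finset.range_eq_Ico]
  have hB := Finset.sum_Ico_consecutive (fun v => g v * pmPow e v) (Nat.zero_le 1)
    (show 1 ≤ 27 by norm_num)
  have hC : ∑ v ∈ Ico (0 : ℕ) 1, g v * pmPow e v = g (absZ 0) * 2 ^ (128 * e (0 : ZMod 53).val) := by
    rw [← Finset.range_eq_Ico, sum_range_one]
    simp [pmPow, absZ]
  have hD : ∑ v ∈ Ico (1 : ℕ) 27, g v * pmPow e v = ∑ v ∈ Ico (1 : ℕ) 27,
      (g (absZ (v : ZMod 53)) * 2 ^ (128 * e (v : ZMod 53).val) +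
        g (absZ (-(v : ZMod 53))) * 2 ^ (128 * e (-(v : ZMod 53)).val)) := by
    refine sum_congr rfl fun v hv => ?_
    rw [mem_Ico] at hv
    rw [pmPow, if_neg (by omega), mul_add, absZ_neg, absZ_natCast (by omega),
      ZMod.val_natCast_of_lt (by omega), val_neg_natCast hv.1 (by omega)]
  omega

/-- The folded loop with multiplicities is the sum over `ℤ₅₃`: `natSum 27 (g v · twice v) = ∑_z g |z|`.
[folklore] -/
theorem natSum_twice (g : ℕ → ℕ) : natSum 27 (fun v => g v * twice v) = ∑ z : ZMod 53, g (absZ z) := by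
  rw [sum_zmod_fold, natSum_eq, Finset.range_eq_Ico]
  have hB := Finset.sum_Ico_consecutive (fun v => g v * twice v) (Nat.zero_le 1)
    (show 1 ≤ 27 by norm_num)
  have hC : ∑ v ∈ Ico (0 : ℕ) 1, g v * twice v = g (absZ 0) := by
    rw [← Finset.range_eq_Ico, sum_range_one]
    simp [twice, absZ]
  have hD : ∑ v ∈ Ico (1 : ℕ) 27, g v * twice v =
      ∑ v ∈ Ico (1 : ℕ) 27, (g (absZ (v : ZMod 53)) + g (absZ (-(v : ZMod 53)))) := by
    refine sum_congr rfl fun v hv => ?_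
    rw [mem_Ico] at hv
    rw [twice, if_neg (by omega), absZ_neg, absZ_natCast (by omega), mul_two]
  omega

/-- Coordinates of `![z₀, z₁, z₂]`. [folklore] -/
theorem vec3_apply (z₀ z₁ z₂ : ZMod 53) :
    (![z₀, z₁, z₂] : Fin 3 → ZMod 53) 0 = z₀ ∧ (![z₀, z₁, z₂] : Fin 3 → ZMod 53) 1 = z₁ ∧
      (![z₀, z₁, z₂] : Fin 3 → ZMod 53) 2 = z₂ := ⟨rfl, rfl, rfl⟩

/-- Sums over `ℤ₅₃³` as triple sums (outermost coordinate last). [folklore] -/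
theorem sum_vec3 (F : (Fin 3 → ZMod 53) → ℕ) :
    ∑ x, F x = ∑ z₂ : ZMod 53, ∑ z₁ : ZMod 53, ∑ z₀ : ZMod 53, F ![z₀, z₁, z₂] := by
  let e : ZMod 53 × ZMod 53 × ZMod 53 ≃ (Fin 3 → ZMod 53) :=
    ⟨fun p => ![p.2.2, p.2.1, p.1], fun x => (x 2, x 1, x 0), fun p => by simp,
      fun x => by funext i; fin_cases i <;> rfl⟩
  rw [← Fintype.sum_equiv e (fun p => F ![p.2.2, p.2.1, p.1]) F (fun p => rfl), Fintype.sum_prod_type]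
  refine sum_congr rfl fun z₂ _ => ?_
  rw [Fintype.sum_prod_type]

/-- `ν` at `![z₀, z₁, z₂]`. [folklore] -/
theorem nuNat_vec3 (z₀ z₁ z₂ : ZMod 53) :
    nuNat ![z₀, z₁, z₂] = nuAbs (absZ z₀) (absZ z₁) (absZ z₂) := rfl

/-! ## §2 The accumulators as sums over `ℤ₅₃³` -/

/-- `acc1 a b = ∑_x ν(x) 2^{128 E₁(x)}` with `E₁(x) = x₀ + (a x₁ mod 53) + (b x₂ mod 53)`
(standard representatives). [folklore] -/
theorem acc1_eq (a b : ℕ) : acc1 a b =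
    ∑ x : Fin 3 → ZMod 53, nuNat x * 2 ^ (128 * ((x 0).val + a * (x 1).val % 53 + b * (x 2).val % 53)) := by
  rw [sum_vec3]
  unfold acc1
  rw [natSum_pmPow]
  refine sum_congr rfl fun z₂ _ => ?_
  unfold sA
  rw [natSum_pmPow, sum_mul]
  refine sum_congr rfl fun z₁ _ => ?_
  unfold rowP
  rw [natSum_pmPow, sum_mul, sum_mul]
  refine sum_congr rfl fun z₀ _ => ?_
  obtain ⟨e0, e1, e2⟩ := vec3_apply z₀ z₁ z₂
  rw [nuNat_vec3, e0, e1, e2, mul_assoc, mul_assoc, ← pow_add, ← pow_add]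
  congr 2
  ring

/-- `acc2 a = ∑_x ν(x) 2^{128 E₂(x)}` with `E₂(x) = x₁ + (a x₂ mod 53)`. [folklore] -/
theorem acc2_eq (a : ℕ) : acc2 a =
    ∑ x : Fin 3 → ZMod 53, nuNat x * 2 ^ (128 * ((x 1).val + a * (x 2).val % 53)) := by
  rw [sum_vec3]
  unfold acc2
  rw [natSum_pmPow]
  refine sum_congr rfl fun z₂ _ => ?_
  unfold planeP
  rw [natSum_pmPow, sum_mul]
  refine sum_congr rfl fun z₁ _ => ?_
  unfold rowSum
  rw [natSum_twice, sum_mul, sum_mul]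
  refine sum_congr rfl fun z₀ _ => ?_
  obtain ⟨-, e1, e2⟩ := vec3_apply z₀ z₁ z₂
  rw [nuNat_vec3, e1, e2, mul_assoc, ← pow_add]
  congr 2
  ring

/-- `acc3 = ∑_x ν(x) 2^{128 x₂}`. [folklore] -/
theorem acc3_eq : acc3 = ∑ x : Fin 3 → ZMod 53, nuNat x * 2 ^ (128 * (x 2).val) := by
  rw [sum_vec3]
  unfold acc3
  rw [natSum_pmPow]
  refine sum_congr rfl fun z₂ _ => ?_
  unfold planeSum
  rw [natSum_twice, sum_mul]
  refine sum_congr rfl fun z₁ _ => ?_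
  unfold rowSum
  rw [natSum_twice, sum_mul]
  refine sum_congr rfl fun z₀ _ => ?_
  obtain ⟨-, -, e2⟩ := vec3_apply z₀ z₁ z₂
  rw [nuNat_vec3, e2]

/-- `total = ∑_x ν(x)`. [folklore] -/
theorem total_eq_sum : total = ∑ x : Fin 3 → ZMod 53, nuNat x := by
  rw [sum_vec3]
  unfold total
  rw [natSum_twice]
  refine sum_congr rfl fun z₂ _ => ?_
  unfold planeSum
  rw [natSum_twice]
  refine sum_congr rfl fun z₁ _ => ?_
  unfold rowSum
  rw [natSum_twice]
  refine sum_congr rfl fun z₀ _ => ?_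
  rw [nuNat_vec3]

/-! ## §3 Digits of packed sums -/

/-- Splitting off the lowest digit of a packed sum. [folklore] -/
theorem sum_pack_succ (D : ℕ → ℕ) (n : ℕ) :
    ∑ k ∈ range (n + 1), D k * 2 ^ (128 * k) =
      D 0 + 2 ^ 128 * ∑ k ∈ range n, D (k + 1) * 2 ^ (128 * k) := by
  rw [sum_range_succ']
  have h0 : D 0 * 2 ^ (128 * 0) = D 0 := by rw [Nat.mul_zero, Nat.pow_zero, Nat.mul_one]
  rw [h0, add_comm, mul_sum]
  exact congrArg (D 0 + ·) (sum_congr rfl fun k _ => by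
    rw [show 128 * (k + 1) = 128 * k + 128 by omega, Nat.pow_add]; ring)

/-- One-dimensional digit extraction: if all `D k < 2^128` then digit `j < n` of
`∑_{k<n} D k · 2^{128k}` is `D j`. [folklore] -/
theorem digit_sum_pow (D : ℕ → ℕ) (hD : ∀ k, D k < 2 ^ 128) {n j : ℕ} (hj : j < n) :
    digit j (∑ k ∈ range n, D k * 2 ^ (128 * k)) = D j := by
  induction j generalizing D n with
  | zero =>
    obtain ⟨n', rfl⟩ : ∃ n', n = n' + 1 := ⟨n - 1, by omega⟩
    rw [sum_pack_succ, digit, Nat.mul_zero, pow_zero, Nat.div_one, Nat.add_mul_mod_self_left,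
      Nat.mod_eq_of_lt (hD 0)]
  | succ j ih =>
    obtain ⟨n', rfl⟩ : ∃ n', n = n' + 1 := ⟨n - 1, by omega⟩
    have hpos : 0 < 2 ^ 128 := by positivity
    rw [sum_pack_succ, digit, Nat.mul_succ, pow_add, mul_comm (2 ^ (128 * j)) (2 ^ 128),
      ← Nat.div_div_eq_div_mul, Nat.add_mul_div_left _ _ hpos, Nat.div_eq_of_lt (hD 0), zero_add]
    exact ih (fun k => D (k + 1)) (fun k => hD (k + 1)) (by omega)

/-- **Digit extraction for packed sums.** For weights `w`, exponents `ex < n` and per-exponent sums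
`< 2^128`, digit `j` of `∑_i w i · 2^{128 ex i}` is `∑_{ex i = j} w i`. [folklore] -/
theorem digit_packed {ι : Type*} (s : Finset ι) (w ex : ι → ℕ) {n : ℕ} (hex : ∀ i ∈ s, ex i < n)
    (hb : ∀ k, ∑ i ∈ s with ex i = k, w i < 2 ^ 128) {j : ℕ} (hj : j < n) :
    digit j (∑ i ∈ s, w i * 2 ^ (128 * ex i)) = ∑ i ∈ s with ex i = j, w i := by
  have h : ∑ i ∈ s, w i * 2 ^ (128 * ex i) =
      ∑ k ∈ range n, (∑ i ∈ s with ex i = k, w i) * 2 ^ (128 * k) := by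
    rw [← Finset.sum_fiberwise_of_maps_to (g := ex) (t := range n) (fun i hi => mem_range.2 (hex i hi))]
    refine sum_congr rfl fun k _ => ?_
    rw [sum_mul]
    refine sum_congr rfl fun i hi => ?_
    rw [(mem_filter.1 hi).2]
  rw [h, digit_sum_pow _ hb hj]

/-- The product of an accumulator with a reversed row, as one packed sum over pairs. [folklore] -/
theorem acc_mul_row_eq (E : (Fin 3 → ZMod 53) → ℕ) (c : ℕ → ℕ) :
    (∑ x : (Fin 3 → ZMod 53), nuNat x * 2 ^ (128 * E x)) * natSum 53 (fun s => c s * 2 ^ (128 * (52 - s))) =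
      ∑ p ∈ (univ : Finset (Fin 3 → ZMod 53)) ×ˢ range 53, nuNat p.1 * c p.2 * 2 ^ (128 * (E p.1 + (52 - p.2))) := by
  rw [natSum_eq, sum_mul_sum, ← sum_product']
  refine sum_congr rfl fun p _ => ?_
  simp only [mul_add, pow_add]
  ring

/-- The exponents of the packed product stay below `209` when `E ≤ 156`. [folklore] -/
theorem pairEx_lt (E : (Fin 3 → ZMod 53) → ℕ) (hE : ∀ x, E x ≤ 156) :
    ∀ p ∈ (univ : Finset (Fin 3 → ZMod 53)) ×ˢ range 53, (E p.1 + (52 - p.2)) < 209 := by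
  intro p _
  have := hE p.1
  omega

/-- Every digit group of the packed product is below `2^128` (crudely: the whole sum is).
[folklore] -/
theorem pair_fiber_lt (E : (Fin 3 → ZMod 53) → ℕ) (c : ℕ → ℕ) (hc : ∀ k, c k ≤ 2 ^ 50)
    (htot : ∑ x : (Fin 3 → ZMod 53), nuNat x < 2 ^ 64) (k : ℕ) :
    ∑ p ∈ (univ : Finset (Fin 3 → ZMod 53)) ×ˢ range 53 with (E p.1 + (52 - p.2)) = k, nuNat p.1 * c p.2 < 2 ^ 128 := by
  calc ∑ p ∈ (univ : Finset (Fin 3 → ZMod 53)) ×ˢ range 53 with (E p.1 + (52 - p.2)) = k, nuNat p.1 * c p.2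
        ≤ ∑ p ∈ (univ : Finset (Fin 3 → ZMod 53)) ×ˢ range 53, nuNat p.1 * c p.2 :=
        sum_le_sum_of_subset_of_nonneg (filter_subset _ _) (fun _ _ _ => Nat.zero_le _)
    _ = (∑ x : (Fin 3 → ZMod 53), nuNat x) * ∑ s ∈ range 53, c s := by
        rw [sum_mul_sum, ← sum_product']
    _ ≤ (∑ x : (Fin 3 → ZMod 53), nuNat x) * ∑ s ∈ range 53, 2 ^ 50 :=
        Nat.mul_le_mul_left _ (sum_le_sum fun s _ => hc s)
    _ ≤ (2 ^ 64 - 1) * ∑ s ∈ range 53, 2 ^ 50 := Nat.mul_le_mul_right _ (by omega)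
    _ < 2 ^ 128 := by rw [sum_const, card_range, smul_eq_mul]; norm_num

/-- The arithmetic of the three digit positions: for `s < 53` and `e ≤ 156`,
`s = e mod 53 ↔ e + (52 - s) ∈ {52, 105, 158}`. [folklore] -/
theorem digitPos_iff (s e : ℕ) (hs : s < 53) (he : e ≤ 156) :
    s = e % 53 ↔ (e + (52 - s) = 52 ∨ (e + (52 - s) = 105 ∨ e + (52 - s) = 158)) := by
  have h53 : e % 53 < 53 := Nat.mod_lt _ (by norm_num)
  have hdiv : e / 53 ≤ 2 := by omega
  have he' := Nat.div_add_mod e 53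
  interval_cases hq : e / 53 <;> omega

/-- `∑_x ν(x) c(E(x) mod 53)` as a sum over the pairs whose row position is `E(x) mod 53`.
[folklore] -/
theorem sum_pairW_filter (E : (Fin 3 → ZMod 53) → ℕ) (c : ℕ → ℕ) :
    ∑ x : (Fin 3 → ZMod 53), nuNat x * c (E x % 53) =
      ∑ p ∈ (univ : Finset (Fin 3 → ZMod 53)) ×ˢ range 53 with p.2 = E p.1 % 53, nuNat p.1 * c p.2 := by
  rw [sum_filter, sum_product]
  refine sum_congr rfl fun x _ => ?_
  dsimp only
  rw [sum_ite_eq' (range 53) (E x % 53) (fun s => nuNat x * c s),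
    if_pos (mem_range.2 (Nat.mod_lt _ (by norm_num)))]

/-- The pairs whose row position is `E(x) mod 53` are those with packed exponent `52`, `105` or
`158`. [folklore] -/
theorem filter_pos_eq (E : (Fin 3 → ZMod 53) → ℕ) (hE : ∀ x, E x ≤ 156) :
    ((univ : Finset (Fin 3 → ZMod 53)) ×ˢ range 53).filter (fun p => p.2 = E p.1 % 53) =
      ((univ : Finset (Fin 3 → ZMod 53)) ×ˢ range 53).filter
        (fun p => (E p.1 + (52 - p.2)) = 52 ∨ ((E p.1 + (52 - p.2)) = 105 ∨ (E p.1 + (52 - p.2)) = 158)) := by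
  -- (membership hypotheses in `univ ×ˢ range 53` are rewritten before being named: a named binder of
  -- that type makes the `constructorNameAsVariable` linter normalise the huge `Finset`)
  refine filter_congr fun p => ?_
  simp only [mem_product, mem_univ, true_and, mem_range]
  intro hp
  exact digitPos_iff p.2 (E p.1) hp (hE p.1)

/-- Summing the weights over the three digit positions gives `∑_x ν(x) c(E(x) mod 53)`. [folklore] -/
theorem sum_pairW_mod (E : (Fin 3 → ZMod 53) → ℕ) (hE : ∀ x, E x ≤ 156) (c : ℕ → ℕ) :
    ∑ p ∈ (univ : Finset (Fin 3 → ZMod 53)) ×ˢ range 53 with (E p.1 + (52 - p.2)) = 52, nuNat p.1 * c p.2 +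
      ∑ p ∈ (univ : Finset (Fin 3 → ZMod 53)) ×ˢ range 53 with (E p.1 + (52 - p.2)) = 105, nuNat p.1 * c p.2 +
      ∑ p ∈ (univ : Finset (Fin 3 → ZMod 53)) ×ˢ range 53 with (E p.1 + (52 - p.2)) = 158, nuNat p.1 * c p.2 =
      ∑ x : (Fin 3 → ZMod 53), nuNat x * c (E x % 53) := by
  have hd1 : Disjoint (((univ : Finset (Fin 3 → ZMod 53)) ×ˢ range 53).filter fun p => (E p.1 + (52 - p.2)) = 52)
      (((univ : Finset (Fin 3 → ZMod 53)) ×ˢ range 53).filter fun p => (E p.1 + (52 - p.2)) = 105 ∨ (E p.1 + (52 - p.2)) = 158) :=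
    disjoint_filter.2 fun p _ h h' => by omega
  have hd2 : Disjoint (((univ : Finset (Fin 3 → ZMod 53)) ×ˢ range 53).filter fun p => (E p.1 + (52 - p.2)) = 105)
      (((univ : Finset (Fin 3 → ZMod 53)) ×ˢ range 53).filter fun p => (E p.1 + (52 - p.2)) = 158) :=
    disjoint_filter.2 fun p _ h h' => by omega
  rw [sum_pairW_filter, filter_pos_eq E hE, filter_or, sum_union hd1, filter_or, sum_union hd2,
    add_assoc]

/-- Digit extraction for the packed product (the specialisation of `digit_packed`, stated in
beta-reduced form). [folklore] -/
theorem digit_pairs (E : (Fin 3 → ZMod 53) → ℕ) (hE : ∀ x, E x ≤ 156) (c : ℕ → ℕ)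
    (hc : ∀ k, c k ≤ 2 ^ 50) (htot : ∑ x : (Fin 3 → ZMod 53), nuNat x < 2 ^ 64) {j : ℕ} (hj : j < 209) :
    digit j (∑ p ∈ (univ : Finset (Fin 3 → ZMod 53)) ×ˢ range 53,
        nuNat p.1 * c p.2 * 2 ^ (128 * (E p.1 + (52 - p.2)))) =
      ∑ p ∈ (univ : Finset (Fin 3 → ZMod 53)) ×ˢ range 53 with (E p.1 + (52 - p.2)) = j,
        nuNat p.1 * c p.2 :=
  -- (the `Finset` argument is passed explicitly: unifying a membership `p ∈ ?s` against
  -- `p ∈ univ ×ˢ range 53` would make the elaborator normalise the huge `Finset`)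
  digit_packed ((univ : Finset (Fin 3 → ZMod 53)) ×ˢ range 53) (fun p => nuNat p.1 * c p.2)
    (fun p => E p.1 + (52 - p.2)) (pairEx_lt E hE) (pair_fiber_lt E c hc htot) hj

/-- **The packed product behind `dot3`.** For an accumulator `∑_x ν(x) 2^{128 E(x)}` with `E ≤ 156`
and a reversed row `∑_{s<53} c(s) 2^{128 (52-s)}` with `c ≤ 2^50`, the digits `52, 105, 158` of the
product add up to `∑_x ν(x) c(E(x) mod 53)`, provided `∑_x ν(x) < 2^64`. [folklore] -/
theorem dot3_packed (E : (Fin 3 → ZMod 53) → ℕ) (hE : ∀ x, E x ≤ 156) (c : ℕ → ℕ) (hc : ∀ k, c k ≤ 2 ^ 50)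
    (htot : ∑ x : (Fin 3 → ZMod 53), nuNat x < 2 ^ 64) :
    dot3 ((∑ x : (Fin 3 → ZMod 53), nuNat x * 2 ^ (128 * E x)) *
        natSum 53 (fun s => c s * 2 ^ (128 * (52 - s)))) =
      ∑ x : (Fin 3 → ZMod 53), nuNat x * c (E x % 53) := by
  refine (congrArg dot3 (acc_mul_row_eq E c)).trans ?_
  refine Eq.trans ?_ (sum_pairW_mod E hE c)
  unfold dot3
  rw [digit_pairs E hE c hc htot (show 52 < 209 by omega), digit_pairs E hE c hc htot (show 105 < 209 by omega),
    digit_pairs E hE c hc htot (show 158 < 209 by omega)]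

/-! ## §4 Real parts of the character sums -/

/-- The real part of the standard additive character: `Re ψ(j) = cos (2π j/53)`. [folklore] -/
theorem stdAddChar_re (j : ZMod 53) : (ZMod.stdAddChar j : ℂ).re = Real.cos (2 * π * j.val / 53) := by
  rw [ZMod.stdAddChar_apply, ZMod.toCircle_apply]
  have h : (2 * π * I * (j.val : ℂ) / (53 : ℕ) : ℂ) = ((2 * π * j.val / 53 : ℝ) : ℂ) * I := by
    push_cast
    ring
  rw [h, exp_ofReal_mul_I_re]

/-- The real part of the character sum of `ν`: `Re ∑_x ν(x) ψ(⟨x,y⟩) = ∑_x ν(x) cos (2π ⟨x,y⟩/53)`.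
[folklore] -/
theorem re_charSum (y : (Fin 3 → ZMod 53)) :
    (∑ x : (Fin 3 → ZMod 53), ((nuNat x : ℝ) : ℂ) * ZMod.stdAddChar (x ⬝ᵥ y)).re =
      ∑ x : (Fin 3 → ZMod 53), (nuNat x : ℝ) * Real.cos (2 * π * (x ⬝ᵥ y).val / 53) := by
  rw [re_sum]
  refine sum_congr rfl fun x _ => ?_
  rw [re_ofReal_mul, stdAddChar_re]

/-- The tables are bounded by `2^48` (kernel check of the `53` entries; `0` beyond). [folklore] -/
theorem cosLo_tables_le :
    ((List.range 53).all fun k => Nat.ble (cosLoP k) (2 ^ 48) && Nat.ble (cosLoN k) (2 ^ 48)) = true ∧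
      cosLoPList.length = 53 ∧ cosLoNList.length = 53 := by
  decide +kernel

/-- `C⁺(k) ≤ 2^48`. [folklore] -/
theorem cosLoP_le (k : ℕ) : cosLoP k ≤ 2 ^ 48 := by
  obtain ⟨hall, hlP, -⟩ := cosLo_tables_le
  rcases Nat.lt_or_ge k 53 with hk | hk
  · have h := List.all_eq_true.1 hall k (List.mem_range.2 hk)
    simp only [Bool.and_eq_true] at h
    exact Nat.le_of_ble_eq_true h.1
  · unfold cosLoP
    rw [List.getD_eq_default _ _ (by omega)]
    exact Nat.zero_le _

/-- `C⁻(k) ≤ 2^48`. [folklore] -/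
theorem cosLoN_le (k : ℕ) : cosLoN k ≤ 2 ^ 48 := by
  obtain ⟨hall, -, hlN⟩ := cosLo_tables_le
  rcases Nat.lt_or_ge k 53 with hk | hk
  · have h := List.all_eq_true.1 hall k (List.mem_range.2 hk)
    simp only [Bool.and_eq_true] at h
    exact Nat.le_of_ble_eq_true h.2
  · unfold cosLoN
    rw [List.getD_eq_default _ _ (by omega)]
    exact Nat.zero_le _

/-- `C⁰(k) ≤ 2^50`. [folklore] -/
theorem cosLo0_le (k : ℕ) : cosLo0 k ≤ 2 ^ 50 := by
  have := cosLoP_le k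
  unfold cosLo0
  omega

/-- `C⁰(k) - 2^48 ≤ 2^48 cos (2πk/53)` as reals, `k < 53`. [folklore] -/
theorem cosLo0_sub_le {k : ℕ} (hk : k < 53) :
    (cosLo0 k : ℝ) - 2 ^ 48 ≤ 2 ^ 48 * Real.cos (2 * π * k / 53) := by
  have h := cosLo_le hk
  have hN := cosLoN_le k
  unfold cosLo0
  rw [Nat.cast_sub (show cosLoN k ≤ cosLoP k + 2 ^ 48 by omega), Nat.cast_add, Nat.cast_pow,
    Nat.cast_ofNat]
  linarith

/-- The total mass is below `2^64` (from the kernel value). [folklore] -/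
theorem sum_nuNat_lt : ∑ x : (Fin 3 → ZMod 53), nuNat x < 2 ^ 64 := by
  rw [← total_eq_sum, verdicts.2.2.2.2.1]
  decide +kernel

/-- **Positivity along a line from the kernel test.** If `acc = ∑_x ν(x) 2^{128 E(x)}` with
`E ≤ 156`, `E(x) ≡ ⟨x,u⟩ (mod 53)`, and `checkAcc acc = true`, then `Re ν̂(t u) ≥ 0` for
`1 ≤ t ≤ 26`. [folklore] -/
theorem re_nonneg_of_checkAcc (E : (Fin 3 → ZMod 53) → ℕ) (hE : ∀ x, E x ≤ 156) (u : (Fin 3 → ZMod 53))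
    (hEu : ∀ x, ((E x : ℕ) : ZMod 53) = x ⬝ᵥ u) {acc : ℕ}
    (hacc : acc = ∑ x : (Fin 3 → ZMod 53), nuNat x * 2 ^ (128 * E x)) (hchk : checkAcc acc = true)
    {t : ℕ} (ht1 : 1 ≤ t) (ht2 : t ≤ 26) :
    0 ≤ (∑ x : (Fin 3 → ZMod 53), ((nuNat x : ℝ) : ℂ) * ZMod.stdAddChar (x ⬝ᵥ ((t : ZMod 53) • u))).re := by
  -- the kernel inequality
  have hmem : t ∈ List.range' 1 26 := by rw [List.mem_range'_1]; omega
  have hk := Nat.le_of_ble_eq_true (List.all_eq_true.1 hchk t hmem)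
  rw [hacc, cosPacked, dot3_packed E hE (fun s => cosLo0 (t * s % 53)) (fun k => cosLo0_le _) sum_nuNat_lt,
    total_eq_sum] at hk
  -- values of the pairing along the line
  have hval : ∀ x : (Fin 3 → ZMod 53), (x ⬝ᵥ ((t : ZMod 53) • u)).val = t * (E x % 53) % 53 := by
    intro x
    rw [dotProduct_smul, smul_eq_mul, ZMod.val_mul, ZMod.val_natCast_of_lt (by omega), ← hEu,
      ZMod.val_natCast]
  -- real side
  rw [re_charSum]
  have hterm : ∀ x : (Fin 3 → ZMod 53), (nuNat x : ℝ) * ((cosLo0 (t * (E x % 53) % 53) : ℝ) - 2 ^ 48) ≤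
      2 ^ 48 * ((nuNat x : ℝ) * Real.cos (2 * π * (x ⬝ᵥ ((t : ZMod 53) • u)).val / 53)) := by
    intro x
    rw [hval x, mul_left_comm]
    exact mul_le_mul_of_nonneg_left (cosLo0_sub_le (Nat.mod_lt _ (by norm_num))) (Nat.cast_nonneg _)
  have hsum := sum_le_sum fun x (_ : x ∈ (univ : Finset (Fin 3 → ZMod 53))) => hterm x
  rw [← mul_sum] at hsum
  have hk' : (2 : ℝ) ^ 48 * (∑ x : (Fin 3 → ZMod 53), (nuNat x : ℝ)) ≤ ∑ x : (Fin 3 → ZMod 53), (nuNat x : ℝ) * (cosLo0 (t * (E x % 53) % 53) : ℝ) := by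
    exact_mod_cast hk
  have hsplit : ∑ x : (Fin 3 → ZMod 53), (nuNat x : ℝ) * ((cosLo0 (t * (E x % 53) % 53) : ℝ) - 2 ^ 48) =
      ∑ x : (Fin 3 → ZMod 53), (nuNat x : ℝ) * (cosLo0 (t * (E x % 53) % 53) : ℝ) - 2 ^ 48 * ∑ x : (Fin 3 → ZMod 53), (nuNat x : ℝ) := by
    rw [mul_sum, ← sum_sub_distrib]
    refine sum_congr rfl fun x _ => ?_
    ring
  rw [hsplit] at hsum
  nlinarith

end Literature.Barriers.AtomisticToContinuum

end
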